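import Mathlib.AlgebraicGeometry.AffineScheme
import HarnessLib

/-!
# Morphisms of schemes: a finite affine open cover ADAPTED to a finite set of closed points

Topic `Literature/AlgebraicGeometry/Morphisms`; namespace `Literature.AlgebraicGeometry.Morphisms`.  THEOREMS ONLY (no definition, no
instance, no notation, no named fact, no `sorry`).  Cell `hodgecm-mathlib` (D-0151), P6 «MOD programme», hand (CBC-4b) cut out of the
CBC-4 head «PIC⁰-ONTO, ANY CHARACTERISTIC» by B-p08 (g34) (2026-09-02): the second-factor cover of [MumfordAV1970] §8 Thm. 1 («the
see-saw ∕ `K(Θ)` argument»), where one needs a finite affine open cover of the (quasi-compact) abelian variety in which every point of the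
finite set `Σ = K(Θ)(k)` of closed points lies in EXACTLY ONE member, so that the columns of the Čech bicomplex indexed by `≥ 2` distinct
opens miss `Σ`.  HC_CM is proved only modulo the printed citations until rung 0 closes; nothing here is about HC.

THE MATHEMATICS (point-set; [GortzWedhorn2020] Prop. 3.2 «affine open subschemes form a basis of the topology», [StacksProject] Tag 01ZU
for the general «affine open containing a finite set of points» theme).  Let `X` be a quasi-compact scheme and `Σ ⊆ X` a finite set of
closed points.  For `y ∈ Σ` the set `X ∖ (Σ ∖ {y})` is open (finite union of closed points), so it contains an AFFINE open neighbourhood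
`V_y` of `y` (Mathlib `Scheme.isBasis_affineOpens`); `V_y` meets `Σ` in `{y}` only (§1).  Likewise every point outside `Σ` has an affine open
neighbourhood missing `Σ`.  The family `{V_y}_{y ∈ Σ} ∪ {U affine open, U ∩ Σ = ∅}` covers `X`; by compactness a finite subfamily does, and
we enumerate it WITHOUT REPETITION (`Finset.equivFin`).  The family is injective on indices (`V_y ∌ y′` for `y′ ≠ y`, `U ∌ y`), so if a point
`x ∈ Σ` lies in two members with distinct indices, both are `V_x` with the same index — contradiction (§2).

MAIN STATEMENT.  §2 **`exists_affineCover_adapted`** — VERBATIM the (CBC-4b) letter: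
`∃ (n : ℕ) (V : Fin n → X.affineOpens), (⨆ j, (V j).1) = ⊤ ∧ ∀ j j′, j ≠ j′ → ∀ x ∈ S, x ∈ (V j).1 → x ∉ (V j′).1`.

## References
* [MumfordAV1970] D. Mumford, *Abelian Varieties* (1970), §8 Theorem 1 (pp. 77–80) and §6 Appendix (the cover in the `K(L)` argument).
* [GortzWedhorn2020] U. Görtz, T. Wedhorn, *Algebraic Geometry I*, 2nd ed. (2020), Prop. 3.2 (p. 68).
* [StacksProject] The Stacks Project, Tag 01ZU (Properties, Lemma 28.29.5: affine open neighbourhoods of finite sets of points).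
-/

set_option autoImplicit false

universe u

open CategoryTheory AlgebraicGeometry TopologicalSpace

namespace Literature.AlgebraicGeometry.Morphisms

/-! ### §1 An affine open neighbourhood of one point of `Σ` missing the others; one missing `Σ` -/

/-- **An affine open `V ∋ y` meeting the finite set `Σ` of closed points in at most `{y}`**: `X ∖ (Σ ∖ {y})` is open (a finite union of
closed points is closed) and affine opens form a basis. [cite: GortzWedhorn2020, Prop. 3.2 (p. 68)] [cite: StacksProject, Tag 01ZU] -/
theorem exists_affineOpen_mem_forall_eq {X : Scheme.{u}} (S : Set X) (hS : S.Finite)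
    (hcl : ∀ x ∈ S, IsClosed ({x} : Set X)) (y : X) :
    ∃ V : X.affineOpens, y ∈ (V : X.Opens) ∧ ∀ x ∈ S, x ∈ (V : X.Opens) → x = y := by
  have hc : IsClosed (⋃ x ∈ S \ {y}, ({x} : Set X)) := (hS.sdiff).isClosed_biUnion fun x hx => hcl x hx.1
  have hyW : y ∈ (⟨(⋃ x ∈ S \ {y}, ({x} : Set X))ᶜ, hc.isOpen_compl⟩ : X.Opens) := by
    change y ∈ (⋃ x ∈ S \ {y}, ({x} : Set X))ᶜ
    rw [Set.mem_compl_iff, Set.mem_iUnion₂]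
    rintro ⟨x, hx, hxy⟩
    exact hx.2 (Set.mem_singleton_iff.mpr (Set.mem_singleton_iff.mp hxy).symm)
  obtain ⟨V, hV, hyV, hVW⟩ := (Opens.isBasis_iff_nbhd.mp X.isBasis_affineOpens) hyW
  refine ⟨⟨V, hV⟩, hyV, fun x hx hxV => ?_⟩
  by_contra hxy
  exact (hVW hxV : x ∈ (⋃ x ∈ S \ {y}, ({x} : Set X))ᶜ)
    (Set.mem_iUnion₂.mpr ⟨x, ⟨hx, fun h => hxy (Set.mem_singleton_iff.mp h)⟩, rfl⟩)

/-- **An affine open neighbourhood of a point outside `Σ` missing `Σ`**: `X ∖ Σ` is open and affine opens form a basis.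
[cite: GortzWedhorn2020, Prop. 3.2 (p. 68)] [cite: StacksProject, Tag 01ZU] -/
theorem exists_affineOpen_mem_forall_not_mem {X : Scheme.{u}} (S : Set X) (hS : S.Finite)
    (hcl : ∀ x ∈ S, IsClosed ({x} : Set X)) {z : X} (hz : z ∉ S) :
    ∃ U : X.affineOpens, z ∈ (U : X.Opens) ∧ ∀ x ∈ S, x ∉ (U : X.Opens) := by
  have hc : IsClosed (⋃ x ∈ S, ({x} : Set X)) := hS.isClosed_biUnion hcl
  have hzW : z ∈ (⟨(⋃ x ∈ S, ({x} : Set X))ᶜ, hc.isOpen_compl⟩ : X.Opens) := by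
    change z ∈ (⋃ x ∈ S, ({x} : Set X))ᶜ
    rw [Set.mem_compl_iff, Set.mem_iUnion₂]
    rintro ⟨x, hx, hzx⟩
    exact hz ((Set.mem_singleton_iff.mp hzx) ▸ hx)
  obtain ⟨U, hU, hzU, hUW⟩ := (Opens.isBasis_iff_nbhd.mp X.isBasis_affineOpens) hzW
  exact ⟨⟨U, hU⟩, hzU, fun x hx hxU =>
    (hUW hxU : x ∈ (⋃ x ∈ S, ({x} : Set X))ᶜ) (Set.mem_iUnion₂.mpr ⟨x, hx, rfl⟩)⟩

/-! ### §2 The adapted finite affine cover -/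

/-- **A FINITE AFFINE OPEN COVER ADAPTED TO A FINITE SET OF CLOSED POINTS.**  If `X` is a quasi-compact scheme and `Σ ⊆ X` a finite set
of closed points, there is a finite affine open cover `V : Fin n → X.affineOpens` (`⨆ⱼ Vⱼ = ⊤`) such that no point of `Σ` lies in two
members with distinct indices (every `x ∈ Σ` lies in exactly one `Vⱼ`).  This is the cover used on the second factor in the `K(Θ)`
argument of [MumfordAV1970] §8 Thm. 1 (`Σ = K(Θ)(k)`).  Proof: the neighbourhoods of §1, a finite subcover by compactness, enumerated
without repetition. [cite: MumfordAV1970, §8 Theorem 1 (pp. 77–80)] [cite: GortzWedhorn2020, Prop. 3.2 (p. 68)] [cite: StacksProject, Tag 01ZU] -/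
theorem exists_affineCover_adapted {X : Scheme.{u}} [CompactSpace X] (S : Set X) (hS : S.Finite)
    (hcl : ∀ x ∈ S, IsClosed ({x} : Set X)) :
    ∃ (n : ℕ) (V : Fin n → X.affineOpens), (⨆ j, (V j).1) = ⊤ ∧
      ∀ j j', j ≠ j' → ∀ x ∈ S, x ∈ (V j).1 → x ∉ (V j').1 := by
  classical
  choose Vpt hVpt_mem hVpt_eq using exists_affineOpen_mem_forall_eq S hS hcl
  -- the index type: one affine neighbourhood per point of `X` adapted at that point, and the affine opens missing `Σ`
  let ι : Type u := X ⊕ {U : X.affineOpens // ∀ x ∈ S, x ∉ (U : X.Opens)}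
  let F : ι → X.affineOpens := fun i => Sum.elim Vpt (fun U => U.1) i
  have hcov : (Set.univ : Set X) ⊆ ⋃ i, ((F i : X.Opens) : Set X) := by
    intro z _
    by_cases hz : z ∈ S
    · exact Set.mem_iUnion.mpr ⟨Sum.inl z, hVpt_mem z⟩
    · obtain ⟨U, hzU, hUS⟩ := exists_affineOpen_mem_forall_not_mem S hS hcl hz
      exact Set.mem_iUnion.mpr ⟨Sum.inr ⟨U, hUS⟩, hzU⟩
  obtain ⟨t, ht⟩ := isCompact_univ.elim_finite_subcover (fun i => ((F i : X.Opens) : Set X))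
    (fun i => (F i : X.Opens).2) hcov
  -- every member containing a point `x ∈ Σ` has index `inl x`
  have key : ∀ (i : ι) (x : X), x ∈ S → x ∈ ((F i : X.Opens) : Set X) → i = Sum.inl x := by
    rintro (y | U) x hx h
    · exact congrArg Sum.inl (hVpt_eq y x hx h).symm
    · exact absurd h (U.2 x hx)
  refine ⟨t.card, fun j => F (t.equivFin.symm j).1, ?_, ?_⟩
  · refine top_le_iff.mp fun z _ => ?_
    obtain ⟨i, hi⟩ := Set.mem_iUnion.mp (ht (Set.mem_univ z))
    obtain ⟨hit, hzi⟩ := Set.mem_iUnion.mp hi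
    refine Opens.mem_iSup.mpr ⟨t.equivFin ⟨i, hit⟩, ?_⟩
    change z ∈ ((F (t.equivFin.symm (t.equivFin ⟨i, hit⟩)).1 : X.Opens) : Set X)
    rw [Equiv.symm_apply_apply]
    exact hzi
  · intro j j' hjj' x hx hxj hxj'
    apply hjj'
    have h1 := key _ x hx hxj
    have h2 := key _ x hx hxj'
    exact t.equivFin.symm.injective (Subtype.ext (h1.trans h2.symm))

end Literature.AlgebraicGeometry.Morphisms
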